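import Summits.KontsevichZagierPeriods.KontsevichZagierPeriods.Theorems.RootDecompWalshStrataHtypeConicSquare
import Summits.KontsevichZagierPeriods.KontsevichZagierPeriods.Theorems.RootDecompWalshStrataEtypeClosedSectors

/-!
# Root decomposition (Walsh strata), part 64 — E-type corners closed: `QuadricBakerDescent` holds (gen 10, §64)

Route `RootDecompWalshStrata`, leaf `QuadricBakerDescent` (stmt-KontsevichZagierPeriods-27597).  The one typed
residual R-Eθ of the v11 head `quadricBakerDescent_of_residuals₁₁` (part 60) — E-type quadrics (`0 < disc`)
whose boundary `B`-wall pair is NOT good in the Lagrange chart — is DISCHARGED, and with it the leaf: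

* `InBaker.of_Equad'` — the E-type theorem in the original frame for EVERY list of adapted conic walls
  (part 43's `InBaker.of_Equad` over the total plane theorem `InBaker.of_Eplane'`, §63);
* `Quadric₃.sqrtDescentW_Etype'` — `[atom, γ√D] ∈ InBaker` for every atom of the wall family of every E-type
  quadric, no side condition (`Quadric₃.sqrtDescentW_generic` + `InBaker.of_Equad'`);
* `quadricBakerDescent_holds : …Theses.RootDecompWalshStrata.QuadricBakerDescent` — the head with NO residual.

The thin strata that `goodWalls` excluded (horizontal pair, centre on the wall conic, double-root radicand off
the centre) are elementary in the slope chart: parts 61–62.  [KontsevichZagier2001 §1.2 rules (1)–(3);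
BCR1998 §2.2; this node]
-/

noncomputable section

open Set MeasureTheory MvPolynomial Literature.NumberTheory.Transcendental
open Literature.ModelTheory.ExponentialFields (IsSemialgebraic)

namespace Summit.KontsevichZagierPeriods.RootDecompWalshStrata.ConicDescent.BallCube

/-! #### 64.1 The E-type theorem in the original frame, every wall list -/

/-- **E-TYPE THEOREM (original frame), EVERY WALL LIST.**  For a rational binary quadratic `D` with `0 < disc`
and a bounded open `ℚ`-semialgebraic `U` on which `D > 0`, whose frontier lies on `D = 0`, on genuine rational
lines and on ANY adapted conic walls `D = q²`: `[U, γ√D] ∈ InBaker` (Lagrange map, rule (2), then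
`InBaker.of_Eplane'`). [KontsevichZagier2001 §1.2 rules (1)–(3); this node] -/
theorem InBaker.of_Equad' (D : Quad2) (hdisc : 0 < D.disc) (γ : ℚ) {n m : ℕ} (ℓ : Fin n → Wall)
    (q : Fin m → Wall) (σ : KZ.IntegralRep 2) (hσo : IsOpen σ.domain) (hσb : Bornology.IsBounded σ.domain)
    (hD : ∀ p ∈ σ.domain, 0 < D.eval (p 0) (p 1))
    (hσi : ∀ p ∈ σ.domain, σ.integrand p = γ * √(D.eval (p 0) (p 1)))
    (hfr : ∀ p ∈ closure σ.domain, p ∉ σ.domain → p ∈ wallLocus (fun p => D.eval (p 0) (p 1)) ℓ q) :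
    InBaker (KZ.of σ) := by
  have h11 := D.d11_ne_of_disc_pos hdisc
  have hdet : D.lagM.det ≠ 0 := by rw [D.lagM_det]; exact one_ne_zero
  obtain ⟨τ, hτd, hτi⟩ := exists_ellRep (D.lagM.isSemialgebraic_image σ.isSemialgebraic_domain)
    (D.lagM.isBounded_image hσb) 1 D.eκ γ D.d11 D.cst
  refine D.lagM.inBaker_to hdet σ τ hτd (fun p hp => ?_) ?_
  · rw [hτi _ (by rw [hτd]; exact mem_image_of_mem _ hp), ellW_eq_erad, ← D.eval_eq_erad h11 hdisc.ne' p,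
      D.lagM_det, hσi p hp]
    simp
  refine InBaker.of_Eplane' ⟨one_pos, D.eκ_pos hdisc⟩ γ D.d11 D.cst h11
    (fun i => (ℓ i).precomp D.lagM.inv) (fun j => (q j).precomp D.lagM.inv) τ
    (by rw [hτd]; exact D.lagM.isOpen_image hdet hσo) (by rw [hτd]; exact D.lagM.isBounded_image hσb)
    ?_ hτi ?_
  · rw [hτd]
    rintro _ ⟨p, hp, rfl⟩
    rw [← D.eval_eq_erad h11 hdisc.ne' p]
    exact hD p hp
  · rw [hτd]
    exact wallLocus_transport D.lagM hdet (fun p => (D.eval_eq_erad h11 hdisc.ne' p).symm)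
      (fun i p => by rw [Wall.precomp_eval, D.lagM.inv_toFun hdet])
      (fun i hg => Wall.precomp_gen _ (D.lagM.inv_det_ne hdet) hg)
      (fun j p => by rw [Wall.precomp_eval, D.lagM.inv_toFun hdet]) hfr

/-! #### 64.2 `hW` on every E-type quadric -/

namespace Quadric₃

variable (K : Quadric₃)

/-- **`hW` ON E-TYPE QUADRICS, NO SIDE CONDITION.**  The hypothesis `hW` of `quadricBakerDescent_of_sqrtDescentW`
holds for every quadric `K` whose fibre discriminant `D` has positive-discriminant quadratic part:
`[atom, γ√D] ∈ InBaker` for every atom of the wall family `K.wfam ℓ₁ ℓ₂ g` and every sign vector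
(`Quadric₃.sqrtDescentW_generic` + `InBaker.of_Equad'`). [KontsevichZagier2001 §1.2; this node] -/
theorem sqrtDescentW_Etype' (hE : 0 < K.dq.disc) (ℓ₁ ℓ₂ g : Wall) (γ : ℚ) (σ : Fin 6 → SignType)
    (r : KZ.IntegralRep 2) (hrd : r.domain = atomFam (K.wfam ℓ₁ ℓ₂ g) σ)
    (hri : EqOn r.integrand (fun v => (γ : ℝ) * √(K.Dxy (v 0) (v 1))) r.domain) :
    InBaker (KZ.of r) :=
  K.sqrtDescentW_generic ℓ₁ ℓ₂ g γ σ r hrd hri fun ho hb hD hi hfr _ _ =>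
    InBaker.of_Equad' K.dq hE γ _ _ r ho hb hD hi hfr

end Quadric₃

/-! #### 64.3 Head: the leaf holds -/

/-- **`QuadricBakerDescent` HOLDS** (stmt-KontsevichZagierPeriods-27597, no residual).  Every rational constant
integrand over `{x ∈ (0,1)^d : P(x) > 0}` with `deg P ≤ 2`, `d ≤ 3` descends to the Baker sector: the v11 head
`quadricBakerDescent_of_residuals₁₁` (parts 30–60: cell reduction, fibre integration to `γ√D`, the wall-family
atoms, the H-type and rank-`≤ 1` strata, the E-type stratum off its thin wall strata) with its last residual
R-Eθ supplied by `Quadric₃.sqrtDescentW_Etype'` (parts 61–64: the thin strata are elementary in the slope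
chart).  [KontsevichZagier2001 §1.2 rules (1)–(3); BCR1998 §2.2; this node] -/
theorem quadricBakerDescent_holds :
    Summit.KontsevichZagierPeriods.KontsevichZagierPeriods.Theses.RootDecompWalshStrata.QuadricBakerDescent :=
  quadricBakerDescent_of_residuals₁₁ fun L ℓ₁ ℓ₂ g γ σ r hE _ hrd hri =>
    L.sqrtDescentW_Etype' hE ℓ₁ ℓ₂ g γ σ r hrd hri

end Summit.KontsevichZagierPeriods.RootDecompWalshStrata.ConicDescent.BallCube

end
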